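import Summits.CriticalPhenomena.CardyFormulaZ2.Theses.CardyMagicRigidity
import Literature.Probability.Percolation.FullPlaneCNL

/-!
# Sketch — crux-ideate stmt-CriticalPhenomena-4833 (LoopLimitZ2EqT), ideator 1, round 1

First lemmas of the two idea cards, typed over existing declarations (they are NOT proved here):

* card `linear-image-pinning`: `linearImage_suffices` — the Langlands–Pouliot–Saint-Aubin form of the
  crux (bond-ℤ² loops `d_CN`-close to SOME orientation-preserving real-linear image of the site-𝕋 loops)
  already implies the crux, by PINNING the linear map with the exact quarter-turn symmetry of `ℤ²`,
  the similarity invariance of the full-plane Camia–Newman law and RSW non-degeneracy.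
* card `triangular-hyperlattice-segment`: `chain_via_intermediate` — the assembly of the one-lattice
  reduction: an intermediate lattice loop family `Y` (bond percolation on the isoradial triangular
  lattice) that is `d_CN`-close to a linear image of bond-ℤ² (blind star–triangle transport, [HM24] /
  Manolescu Thm 5.4) and `d_CN`-close to site-𝕋 (universality along the Chayes–Lei / Bollobás–Riordan
  self-dual triangular hyperlattice segment) gives the crux.
-/

noncomputable section

namespace Summit.CriticalPhenomena.CardyFormulaZ2.Cruxes.LoopLimitZ2EqT.IdeatorOne

open MeasureTheory Filter Set
open scoped Topology ENNReal unitInterval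
open Literature.Probability.RandomPlanarGeometry
open Literature.Probability.Percolation Literature.Probability.LatticeModels
open Summit.CriticalPhenomena.CardyFormulaZ2.Theses.CardyMagicRigidity (LoopLimitZ2EqT)

/-- The real-linear map `z ↦ a z + b z̄` of `ℂ ≅ ℝ²` as a continuous map (orientation-preserving and
invertible iff `‖b‖ < ‖a‖`; every `M ∈ GL₂⁺(ℝ)` is of this form). -/
def shearMap (a b : ℂ) : C(ℂ, ℂ) :=
  ⟨fun z ↦ a * z + b * (starRingEnd ℂ) z, by fun_prop⟩

/-- Push-forward of a typed loop configuration along `z ↦ a z + b z̄` (types kept; members are pushed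
forward as based loops, `BasedLoop.map`, then unbased again). -/
def shearConfig (a b : ℂ) (c : LoopConfig ℂ) : LoopConfig ℂ where
  F i := {u | ∃ ℓ : BasedLoop ℂ, UnbasedLoop.mk ℓ ∈ c.F i ∧ u = UnbasedLoop.mk (ℓ.map (shearMap a b))}

/-- **X⁺ — the shear-blind (Langlands–Pouliot–Saint-Aubin) form of the crux**: for SOME
orientation-preserving invertible real-linear `M : z ↦ a z + b z̄` (`‖b‖ < ‖a‖`), the full-plane typed
loop configuration of bond percolation on `δℤ²` at `p = 1/2` and the `M`-image of that of site
percolation on `δ𝕋` at `p = 1/2` become `d_CN`-indistinguishable as `δ → 0⁺`. -/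
def LinearImageLoopLimit : Prop :=
  ∃ a b : ℂ, ‖b‖ < ‖a‖ ∧
    Tendsto (fun δ : ℝ ↦ LoopConfig.cnLawEDist (bondPercolation (zdGraph 2) half) (bondLoopConfig δ 0)
      (triSitePercolation half) (fun cfg ↦ shearConfig a b (siteLoopConfig δ cfg)))
      (𝓝[>] 0) (𝓝 0)

/-- **Similarity invariance of the full-plane Camia–Newman law** (CLE₆ is invariant in law under
rotations and dilations of the plane; Camia–Newman 2006 Thm 2 with Smirnov 2001 / the scale invariance
is elementary from the definition as a `δ → 0⁺` limit): the image of a full-plane CNL law under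
`z ↦ a z`, `a ≠ 0`, is a full-plane CNL law. Conjecture-grade named input of the pinning lemma (not a
Literature fact yet). -/
def CNLSimilarityInvariance : Prop :=
  ∀ (X : unitInterval → LoopConfig ℂ), IsFullPlaneCNLLaw volume X →
    ∀ a : ℂ, a ≠ 0 → IsFullPlaneCNLLaw volume (fun t ↦ shearConfig a 0 (X t))

/-- **First lemma of card `linear-image-pinning` (PINNING).** Given the existence of the full-plane
Camia–Newman law (named fact `exists_isFullPlaneCNLLaw`) and its similarity invariance, the
shear-blind statement `LinearImageLoopLimit` implies the crux `LoopLimitZ2EqT`.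
Mechanism: the `d_CN`-limit of bond-ℤ² exists and equals `M_* P` (`P` = CLE₆); it is invariant under
the exact quarter-turn of `ℤ²` and under `M SO(2) M⁻¹`; unless `M ∈ ℝ₊·SO(2)` these generate (KAK) a
diagonal `diag(s, 1/s)`, `s > 1`, whose powers contradict RSW thin-corridor decay; so `M` is a
similarity and `M_* P = P`. -/
theorem linearImage_suffices (hCN : exists_isFullPlaneCNLLaw) (hSim : CNLSimilarityInvariance) :
    LinearImageLoopLimit → LoopLimitZ2EqT := by
  sorry

/-- **First lemma of card `triangular-hyperlattice-segment` (CHAIN).** For any intermediate lattice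
loop family `Y δ` on a standard Borel probability space (intended: the typed interface loops of bond
percolation on the isoradial triangular lattice `δ𝕋` at `p = 2 sin(π/18)`): if `Y` is `d_CN`-close to
a linear image of the bond-ℤ² configuration (blind star–triangle transport: Manolescu 2025 Thm 5.4 /
[HM24]) and `d_CN`-close to the site-𝕋 configuration (one-lattice universality along the self-dual
triangular hyperlattice segment), then the crux holds (triangle inequality for `d_CN`, linear
distortion of `d_CN`, and `linearImage_suffices`). -/
theorem chain_via_intermediate (hCN : exists_isFullPlaneCNLLaw) (hSim : CNLSimilarityInvariance)
    {Ω : Type*} [MeasurableSpace Ω] [StandardBorelSpace Ω] [Nonempty Ω]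
    (μ : Measure Ω) [IsProbabilityMeasure μ] (Y : ℝ → Ω → LoopConfig ℂ)
    (hT : ∃ a b : ℂ, ‖b‖ < ‖a‖ ∧
      Tendsto (fun δ : ℝ ↦ LoopConfig.cnLawEDist μ (Y δ) (bondPercolation (zdGraph 2) half)
        (fun ω ↦ shearConfig a b (bondLoopConfig δ 0 ω))) (𝓝[>] 0) (𝓝 0))
    (hS : Tendsto (fun δ : ℝ ↦ LoopConfig.cnLawEDist μ (Y δ) (triSitePercolation half)
        (siteLoopConfig δ)) (𝓝[>] 0) (𝓝 0)) :
    LoopLimitZ2EqT := by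
  sorry

/-- Sanity: the crux is literally the `M = id` instance of the shear-blind statement's conclusion
shape (so X ⇒ X⁺ trivially once `shearConfig 1 0 = id` is available). -/
example : LoopLimitZ2EqT ↔
    Tendsto (fun δ : ℝ ↦ LoopConfig.cnLawEDist (bondPercolation (zdGraph 2) half) (bondLoopConfig δ 0)
      (triSitePercolation half) (siteLoopConfig δ)) (𝓝[>] 0) (𝓝 0) := Iff.rfl

end Summit.CriticalPhenomena.CardyFormulaZ2.Cruxes.LoopLimitZ2EqT.IdeatorOne
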